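import Summits.NavierStokesRegularity.NavierStokesRegularity.Theorems.CircuitTrace.Negative.LoadBearing
import Literature.Analysis.FluidPDE.TaoCascadeODEHolds

/-!
# `PerpetualPump.CircuitTrace` (crux stmt-NavierStokesRegularity-1836): the bridge to Tao's
# encoding, and the `ℓ³` hypothesis is load-bearing — negative-side support, III (cdisprove seat)

Sorry-free. Two things:

* THE BRIDGE (reusable by every seat of route PerpetualPump — `CircuitPump`, `PumpTransfer`,
  `CircuitTrace` — that wants Tao's Table-1 circuit or Theorem 4.2 in the route's encoding):
  `shiftOf : Option (Fin 3) → ℤ³` and `coeffOf α` re-encode Tao's `ℤ³`-indexed structure constants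
  (`Literature.Analysis.FluidPDE.TaoCascade`, shift set `S`) in the route's `Option (Fin 3)`
  labels; `quadTerm_eq_sum_option` and `circuitRHS_coeffOf` identify the route's circuit
  right-hand side at `lam = (1+ε₀)^{5/2}` with Tao's viscous model
  `-(1+ε₀)^{2n}X_{i,n} + [quadratic term (4.8)]`; `isSymm_coeffOf`, `isCyclic_coeffOf` transfer
  (4.2)/(4.3) (`univ_perm_fin_three` / `sum_perm_fin_three` expand `∑ σ : Perm (Fin 3)`).
* `circuitTraceWithoutL3_false`: granted the standard well-posedness input
  `MaximalH10Solutions` (maximal `H¹⁰` solutions of the circuit class with the blow-up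
  alternative — Duhamel/Picard in `{sup_n lam^{4n}|x_n| < ∞}`; NOT in tree, stated here as a
  precise `Prop` for construction), the `ℓ³`-free variant `CircuitTraceWithoutL3` is FALSE, by
  Tao's Theorem 4.2 (tree: `TaoCascade.odeBlowup_holds`): an exact global regular solution of the
  viscous circuit is a `CascadeODESolution` with `E = X²/2`, `K₁ = √2`, `K₂ = 0`, which Thm. 4.2
  forbids from one excited mode at a large scale; so the maximal solution blows up in `H¹⁰` at a
  finite time, where the variant would bound it. Together with companion I
  (`circuitTrace_false_without_apriori`) this completes the disprover's load-bearing map: both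
  quantitative hypotheses of the crux are necessary.

No statement here asserts a `Theses` decl positively. [folklore]
-/

noncomputable section

set_option linter.dupNamespace false

namespace Summit.NavierStokesRegularity.NavierStokesRegularity.Theorems.CircuitTrace.Negative

open Finset Real Set
open Literature.Analysis.FluidPDE.TaoCascade

/-! ### The two encodings of the offset set -/

/-- The offset vector `(μ₁, μ₂, μ₃) ∈ S ⊂ ℤ³` of an `Option (Fin 3)` label:
`none ↦ (0,0,0)`, `some a ↦ e_a`. -/
def shiftOf (μ : Option (Fin 3)) : ℤ × ℤ × ℤ :=
  Option.elim μ (0, 0, 0) ![(1, 0, 0), (0, 1, 0), (0, 0, 1)]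

/-- `none ↦ (0,0,0)`. -/
@[simp] theorem shiftOf_none : shiftOf none = (0, 0, 0) := rfl
/-- `some 0 ↦ (1,0,0)`. -/
@[simp] theorem shiftOf_zero : shiftOf (some 0) = (1, 0, 0) := rfl
/-- `some 1 ↦ (0,1,0)`. -/
@[simp] theorem shiftOf_one : shiftOf (some 1) = (0, 1, 0) := rfl
/-- `some 2 ↦ (0,0,1)`. -/
@[simp] theorem shiftOf_two : shiftOf (some 2) = (0, 0, 1) := rfl

/-- Tao's `ℤ³`-indexed structure constants read in the `Option (Fin 3)` encoding of the route. -/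
def coeffOf {m : ℕ} (α : Fin m → Fin m → Fin m → ℤ × ℤ × ℤ → ℝ) :
    Fin m → Fin m → Fin m → Option (Fin 3) → ℝ :=
  fun i₁ i₂ i₃ μ => α i₁ i₂ i₃ (shiftOf μ)

/-- Summing over the four labels is summing over the shift set `S`. -/
theorem sum_option_eq_sum_shiftSet {M : Type*} [AddCommMonoid M] (f : ℤ × ℤ × ℤ → M) :
    ∑ μ : Option (Fin 3), f (shiftOf μ) = ∑ μ ∈ shiftSet, f μ := by
  rw [sum_shiftSet, Fintype.sum_option, Fin.sum_univ_three]
  simp only [shiftOf_none, shiftOf_zero, shiftOf_one, shiftOf_two]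
  abel

/-- Tao's quadratic term (4.8)/(4.13) written with the `Option (Fin 3)` labels. -/
theorem quadTerm_eq_sum_option (ε₀ : ℝ) {m : ℕ} (α : Fin m → Fin m → Fin m → ℤ × ℤ × ℤ → ℝ)
    (X : Fin m → ℤ → ℝ → ℝ) (i : Fin m) (n : ℤ) (t : ℝ) :
    quadTerm ε₀ α X i n t = ∑ i₁ : Fin m, ∑ i₂ : Fin m, ∑ μ : Option (Fin 3),
      α i₁ i₂ i (shiftOf μ) * (1 + ε₀) ^ ((5 : ℝ) * (n - (shiftOf μ).2.2) / 2) *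
        (X i₁ (n - (shiftOf μ).2.2 + (shiftOf μ).1) t *
          X i₂ (n - (shiftOf μ).2.2 + (shiftOf μ).2.1) t) := by
  unfold quadTerm
  refine Finset.sum_congr rfl fun i₁ _ => Finset.sum_congr rfl fun i₂ _ => ?_
  exact (sum_option_eq_sum_shiftSet (fun μ => α i₁ i₂ i μ *
    (1 + ε₀) ^ ((5 : ℝ) * (n - μ.2.2) / 2) * (X i₁ (n - μ.2.2 + μ.1) t * X i₂ (n - μ.2.2 + μ.2.1) t))).symm

/-- **The route's circuit class at `lam = (1+ε₀)^{5/2}` IS Tao's viscous model (4.13)**: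
`F_{i,n} = -(1+ε₀)^{2n} X_{i,n} + [quadratic term of (4.8)]` for the re-encoded constants. -/
theorem circuitRHS_coeffOf {ε₀ : ℝ} (hε₀ : -1 < ε₀) {m : ℕ}
    (α : Fin m → Fin m → Fin m → ℤ × ℤ × ℤ → ℝ) (X : Fin m → ℤ → ℝ → ℝ) (i : Fin m) (n : ℤ)
    (t : ℝ) :
    circuitRHS ((1 + ε₀) ^ ((5 : ℝ) / 2)) (coeffOf α) X i n t =
      -((1 + ε₀) ^ ((2 : ℝ) * n)) * X i n t + quadTerm ε₀ α X i n t := by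
  have h0 : 0 ≤ 1 + ε₀ := by linarith
  rw [quadTerm_eq_sum_option]
  unfold circuitRHS coeffOf
  congr 1
  · rw [← Real.rpow_mul h0]
    congr 2
    ring
  · refine Finset.sum_congr rfl fun i₁ _ => Finset.sum_congr rfl fun i₂ _ =>
      Finset.sum_congr rfl fun μ _ => ?_
    rw [← Real.rpow_mul h0]
    rcases μ with _ | a
    · simp only [reduceCtorEq, ite_false, sub_zero, add_zero, shiftOf_none, Int.cast_zero]
      ring_nf
    · fin_cases a
      · simp only [Fin.zero_eta, Fin.isValue, Option.some.injEq, Fin.reduceEq, ite_false,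
          sub_zero, ite_true, shiftOf_zero, Int.cast_zero, add_zero]
        ring_nf
      · simp only [Fin.mk_one, Fin.isValue, Option.some.injEq, Fin.reduceEq, ite_false,
          sub_zero, ite_true, add_zero, shiftOf_one, Int.cast_zero]
        ring_nf
      · simp only [Fin.reduceFinMk, Fin.isValue, ite_true, Option.some.injEq, Fin.reduceEq,
          ite_false, zero_sub, shiftOf_two, Int.cast_one, add_zero]
        ring_nf

/-- Symmetry (4.2) transfers to the `Option (Fin 3)` encoding. -/
theorem isSymm_coeffOf {m : ℕ} {α : Fin m → Fin m → Fin m → ℤ × ℤ × ℤ → ℝ}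
    (h : IsSymmetricCoeff α) : IsSymm (coeffOf α) := by
  intro i₁ i₂ i₃ μ
  rcases μ with _ | a
  · exact h i₁ i₂ i₃ 0 0 0 (by decide)
  · fin_cases a
    · exact h i₁ i₂ i₃ 1 0 0 (by decide)
    · exact h i₁ i₂ i₃ 0 1 0 (by decide)
    · exact h i₁ i₂ i₃ 0 0 1 (by decide)

/-- The six permutations of `Fin 3`, for expanding `∑ σ : Perm (Fin 3)`. -/
theorem univ_perm_fin_three : (Finset.univ : Finset (Equiv.Perm (Fin 3))) =
    {1, Equiv.swap 0 1, Equiv.swap 0 2, Equiv.swap 1 2, Equiv.swap 0 1 * Equiv.swap 0 2,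
      Equiv.swap 0 2 * Equiv.swap 0 1} := by
  symm
  apply Finset.eq_univ_of_card
  rw [Fintype.card_perm, Fintype.card_fin]
  decide

/-- `∑ σ : Perm (Fin 3)` written out. -/
theorem sum_perm_fin_three {M : Type*} [AddCommMonoid M] (f : Equiv.Perm (Fin 3) → M) :
    ∑ σ : Equiv.Perm (Fin 3), f σ =
      f 1 + f (Equiv.swap 0 1) + f (Equiv.swap 0 2) + f (Equiv.swap 1 2) +
        f (Equiv.swap 0 1 * Equiv.swap 0 2) + f (Equiv.swap 0 2 * Equiv.swap 0 1) := by
  rw [univ_perm_fin_three, Finset.sum_insert (by decide), Finset.sum_insert (by decide),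
    Finset.sum_insert (by decide), Finset.sum_insert (by decide), Finset.sum_insert (by decide),
    Finset.sum_singleton]
  abel

/-- Cancellation (4.3) transfers to the `Option (Fin 3)` encoding. -/
theorem isCyclic_coeffOf {m : ℕ} {α : Fin m → Fin m → Fin m → ℤ × ℤ × ℤ → ℝ}
    (h : IsCancellingCoeff α) : IsCyclic (coeffOf α) := by
  intro v μ
  rw [sum_perm_fin_three]
  simp only [coeffOf]
  rcases μ with _ | a
  · have := h (v 0) (v 1) (v 2) 0 0 0 (by decide)
    simp only [Option.map_none, shiftOf_none, Equiv.Perm.one_apply, Equiv.swap_apply_left,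
      Equiv.swap_apply_right, Equiv.Perm.mul_apply, Fin.isValue] at this ⊢
    simp only [Equiv.swap_apply_def, Fin.isValue, Fin.reduceEq, ite_false, ite_true] at this ⊢
    linarith
  · have h1s : (1 : Equiv.Perm (Fin 3)).symm = 1 := rfl
    fin_cases a
    · have := h (v 0) (v 1) (v 2) 1 0 0 (by decide)
      simp [Equiv.swap_apply_def, Equiv.Perm.mul_def, Equiv.symm_swap, h1s] at this ⊢
      linarith
    · have := h (v 0) (v 1) (v 2) 0 1 0 (by decide)
      simp [Equiv.swap_apply_def, Equiv.Perm.mul_def, Equiv.symm_swap, h1s] at this ⊢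
      linarith
    · have := h (v 0) (v 1) (v 2) 0 0 1 (by decide)
      simp [Equiv.swap_apply_def, Equiv.Perm.mul_def, Equiv.symm_swap, h1s] at this ⊢
      linarith

/-! ### The `ℓ³` hypothesis is load-bearing: without it, Tao's Theorem 4.2 circuit blows up -/

/-- `CircuitTrace` with the `ℓ³`-critical hypothesis DELETED: an unconditional
`H¹⁰`-continuation claim for every admissible circuit. -/
def CircuitTraceWithoutL3 : Prop :=
  ∀ lam : ℝ, 1 < lam → ∀ (m : ℕ) (coeff : Fin m → Fin m → Fin m → Option (Fin 3) → ℝ),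
    IsSymm coeff → IsCyclic coeff → ∀ T : ℝ, 0 < T → ∀ X : Fin m → ℤ → ℝ → ℝ,
    (∀ (i : Fin m) (n : ℤ), ContinuousOn (X i n) (Set.Ico 0 T)) →
    (∀ (i : Fin m) (n : ℤ), ∀ t ∈ Set.Ioo 0 T, HasDerivAt (X i n) (circuitRHS lam coeff X i n t) t) →
    (∀ (i : Fin m) (n : ℤ) (t : ℝ), n < 0 → X i n t = 0) →
    (∀ T' ∈ Set.Ioo 0 T, ∃ C : ℝ, ∀ (i : Fin m) (n : ℤ), ∀ t ∈ Set.Icc 0 T',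
        lam ^ ((4 : ℝ) * n) * |X i n t| ≤ C) →
    ∃ C : ℝ, ∀ (i : Fin m) (n : ℤ), ∀ t ∈ Set.Ico 0 T, lam ^ ((4 : ℝ) * n) * |X i n t| ≤ C

/-- The well-posedness input (standard, NOT in tree; filed for construction): **maximal `H¹⁰`
solutions with the blow-up alternative** for the circuit class, from one excited mode. For every
`lam > 1`, every admissible circuit and the datum `X_{i,n}(0) = 1_{(i,n)=(i₀,n₀)}` (`n₀ ≥ 0`),
EITHER there is a global solution — `C¹` on `[0,∞)` (one-sided at `t = 0`), vanishing below
scale `n₀`, a-priori bounded in `sup_n lam^{4n}|X_{i,n}|` on every `[0,T]` — OR there is a solution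
on some `[0,T*)`, `0 < T* < ∞`, with the same properties on compact sub-intervals, whose weighted
amplitude `lam^{4n}|X_{i,n}(t)|` is unbounded on `[0,T*)`. (Proof sketch, for whoever constructs
it: with the cutoff the nonlinearity is locally Lipschitz on the Banach space
`{sup_n lam^{4n}|x_n| < ∞}` — `lam^{4n}|N_n(x)| ≤ 4m²K lam^{8-3n}‖x‖²` for `n ≥ 0` — and the
dissipation is diagonal, so the Duhamel formulation `x(t) = e^{tA}x₀ + ∫₀ᵗ e^{(t-s)A}N(x(s))ds`,
`A = -diag(lam^{4n/5})`, is a contraction on short time intervals; components are then classical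
solutions of scalar linear ODEs with continuous forcing; continuation is the usual argument.)
It is used here ONLY as the hypothesis of `circuitTraceWithoutL3_false` (negative lemma modulo `H`);
nothing in this file asserts it. -/
def MaximalH10Solutions : Prop :=
  ∀ lam : ℝ, 1 < lam → ∀ (m : ℕ) (coeff : Fin m → Fin m → Fin m → Option (Fin 3) → ℝ),
    IsSymm coeff → IsCyclic coeff → ∀ (i₀ : Fin m) (n₀ : ℤ), 0 ≤ n₀ →
    (∃ X : Fin m → ℤ → ℝ → ℝ,
      (∀ (i : Fin m) (n : ℤ), ContDiffOn ℝ 1 (X i n) (Set.Ici 0)) ∧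
      (∀ (i : Fin m) (n : ℤ) (t : ℝ), 0 ≤ t →
        HasDerivWithinAt (X i n) (circuitRHS lam coeff X i n t) (Set.Ici 0) t) ∧
      (∀ (i : Fin m) (n : ℤ), X i n 0 = if i = i₀ ∧ n = n₀ then 1 else 0) ∧
      (∀ (i : Fin m) (n : ℤ) (t : ℝ), n < n₀ → X i n t = 0) ∧
      (∀ T : ℝ, 0 < T → ∃ C : ℝ, ∀ (i : Fin m) (n : ℤ), ∀ t ∈ Set.Icc 0 T,
        lam ^ ((4 : ℝ) * n) * |X i n t| ≤ C)) ∨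
    (∃ T : ℝ, 0 < T ∧ ∃ X : Fin m → ℤ → ℝ → ℝ,
      (∀ (i : Fin m) (n : ℤ), ContinuousOn (X i n) (Set.Ico 0 T)) ∧
      (∀ (i : Fin m) (n : ℤ), ∀ t ∈ Set.Ioo 0 T,
        HasDerivAt (X i n) (circuitRHS lam coeff X i n t) t) ∧
      (∀ (i : Fin m) (n : ℤ), X i n 0 = if i = i₀ ∧ n = n₀ then 1 else 0) ∧
      (∀ (i : Fin m) (n : ℤ) (t : ℝ), n < n₀ → X i n t = 0) ∧
      (∀ T' ∈ Set.Ioo 0 T, ∃ C : ℝ, ∀ (i : Fin m) (n : ℤ), ∀ t ∈ Set.Icc 0 T',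
        lam ^ ((4 : ℝ) * n) * |X i n t| ≤ C) ∧
      (∀ C : ℝ, ∃ (i : Fin m) (n : ℤ), ∃ t ∈ Set.Ico 0 T, C < lam ^ ((4 : ℝ) * n) * |X i n t|))

/-- `√(x²/2) = |x|/√2`. -/
theorem sqrt_half_sq (x : ℝ) : Real.sqrt (1 / 2 * x ^ 2) = |x| / Real.sqrt 2 := by
  rw [show (1 / 2 : ℝ) * x ^ 2 = x ^ 2 / 2 by ring, Real.sqrt_div (sq_nonneg x),
    Real.sqrt_sq_eq_abs]

/-- **The `ℓ³` hypothesis of `CircuitTrace` is load-bearing.** Granted maximal `H¹⁰` solutions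
with the blow-up alternative (`MaximalH10Solutions`, standard), the `ℓ³`-free variant is FALSE:
Tao's Theorem 4.2 circuit (tree: `TaoCascade.odeBlowup_holds`, at `ε₀ = 1/2`,
`lam = (3/2)^{5/2}`, re-encoded by `coeffOf`) has no global regular solution from one excited
mode, so its maximal solution blows up in `H¹⁰` at a finite time, where the variant would bound
it. (An exact solution of the viscous circuit is a `CascadeODESolution` with `E = X²/2`,
`K₁ = √2` — the dissipation is Tao's `O((1+ε₀)^{2n}E^{1/2})` term — and `K₂ = 0`.) -/
theorem circuitTraceWithoutL3_false (H : MaximalH10Solutions) : ¬ CircuitTraceWithoutL3 := by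
  intro hCT
  obtain ⟨m, i₀, α, hαs, hαc, hN⟩ := odeBlowup_holds (1 / 2) (by norm_num) (by norm_num)
  obtain ⟨N₀, hN₀⟩ := hN (Real.sqrt 2) 0 (Real.sqrt_nonneg _) le_rfl
  set n₀ : ℤ := max N₀ 0 with hn₀
  set lam : ℝ := (1 + 1 / 2 : ℝ) ^ ((5 : ℝ) / 2) with hlam
  have h32 : (0 : ℝ) ≤ 1 + 1 / 2 := by norm_num
  have hlam1 : 1 < lam := Real.one_lt_rpow (by norm_num) (by norm_num)
  have hε : (-1 : ℝ) < 1 / 2 := by norm_num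
  -- `lam^{4n} = (3/2)^{10n}` and `lam^{4n/5} = (3/2)^{2n}`
  have hpow10 : ∀ n : ℤ, lam ^ ((4 : ℝ) * n) = (1 + 1 / 2 : ℝ) ^ ((10 : ℝ) * n) := by
    intro n; rw [hlam, ← Real.rpow_mul h32]; congr 1; ring
  rcases H lam hlam1 m (coeffOf α) (isSymm_coeffOf hαs) (isCyclic_coeffOf hαc) i₀ n₀
      (le_max_right _ _) with
    ⟨X, hC1, hderiv, hinit, hlow, hapr⟩ | ⟨T, hT, X, hcont, hderiv, hinit, hlow, hapr, hunb⟩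
  · -- global branch: an exact global regular solution contradicts Thm. 4.2
    refine hN₀ n₀ (le_max_left _ _) ⟨X, fun i n t => 1 / 2 * X i n t ^ 2, ?_⟩
    have hFn : ∀ (i : Fin m) (n : ℤ) (t : ℝ), 0 ≤ t →
        derivWithin (X i n) (Set.Ici 0) t =
          -((1 + 1 / 2 : ℝ) ^ ((2 : ℝ) * n)) * X i n t + quadTerm (1 / 2) α X i n t := by
      intro i n t ht
      rw [(hderiv i n t ht).derivWithin (uniqueDiffOn_Ici 0 t ht), hlam, circuitRHS_coeffOf hε]
    have hEn : ∀ (i : Fin m) (n : ℤ) (t : ℝ), 0 ≤ t →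
        derivWithin (fun t => 1 / 2 * X i n t ^ 2) (Set.Ici 0) t =
          X i n t * (-((1 + 1 / 2 : ℝ) ^ ((2 : ℝ) * n)) * X i n t + quadTerm (1 / 2) α X i n t) := by
      intro i n t ht
      have h1 := ((hderiv i n t ht).mul (hderiv i n t ht)).const_mul (1 / 2 : ℝ)
      have h2 : derivWithin (fun t => 1 / 2 * X i n t ^ 2) (Set.Ici 0) t =
          1 / 2 * (circuitRHS lam (coeffOf α) X i n t * X i n t +
            X i n t * circuitRHS lam (coeffOf α) X i n t) := by
        rw [← h1.derivWithin (uniqueDiffOn_Ici 0 t ht)]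
        congr 1; funext s; simp only [Pi.mul_apply]; ring
      rw [h2, hlam, circuitRHS_coeffOf hε]; ring
    exact
      { contDiffOn_X := hC1
        contDiffOn_E := fun i n => contDiffOn_const.mul ((hC1 i n).pow 2)
        nonneg_E := fun i n t _ => by positivity
        apriori_X := by
          intro T' hT'
          obtain ⟨C, hC⟩ := hapr T' hT'
          refine ⟨2 * max C 0, fun t ht i n => ?_⟩
          have hb := hC i n t ht
          rw [hpow10] at hb
          by_cases hn : n < n₀
          · rw [hlow i n t hn, abs_zero, mul_zero]; positivity
          · have hn0 : (0 : ℝ) ≤ n := by exact_mod_cast le_trans (le_max_right _ _) (not_lt.mp hn)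
            have h1 : (1 : ℝ) ≤ (1 + 1 / 2 : ℝ) ^ ((10 : ℝ) * n) :=
              Real.one_le_rpow (by norm_num) (by positivity)
            have h2 : |X i n t| ≤ max C 0 :=
              le_trans (le_trans (le_mul_of_one_le_left (abs_nonneg _) h1) hb) (le_max_left _ _)
            have h3 : (1 + 1 / 2 : ℝ) ^ ((10 : ℝ) * n) * |X i n t| ≤ max C 0 :=
              hb.trans (le_max_left _ _)
            nlinarith
        apriori_E := by
          intro T' hT'
          obtain ⟨C, hC⟩ := hapr T' hT'
          refine ⟨2 * max C 0, fun t ht i n => ?_⟩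
          have hb := hC i n t ht
          rw [hpow10] at hb
          have hsq : Real.sqrt (1 / 2 * X i n t ^ 2) ≤ |X i n t| := by
            rw [sqrt_half_sq]
            exact div_le_self (abs_nonneg _) (by
              rw [show (1:ℝ) = Real.sqrt 1 from Real.sqrt_one.symm]
              exact Real.sqrt_le_sqrt (by norm_num))
          have hpos : 0 ≤ 1 + (1 + 1 / 2 : ℝ) ^ ((10 : ℝ) * n) := by positivity
          by_cases hn : n < n₀
          · rw [hlow i n t hn]; simp
          · have h1 : (1 : ℝ) ≤ (1 + 1 / 2 : ℝ) ^ ((10 : ℝ) * n) := by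
              have hn0 : (0 : ℝ) ≤ n := by
                exact_mod_cast le_trans (le_max_right _ _) (not_lt.mp hn)
              exact Real.one_le_rpow (by norm_num) (by positivity)
            have h2 : |X i n t| ≤ max C 0 :=
              le_trans (le_trans (le_mul_of_one_le_left (abs_nonneg _) h1) hb) (le_max_left _ _)
            have h3 : (1 + 1 / 2 : ℝ) ^ ((10 : ℝ) * n) * |X i n t| ≤ max C 0 :=
              hb.trans (le_max_left _ _)
            calc (1 + (1 + 1 / 2 : ℝ) ^ ((10 : ℝ) * n)) * Real.sqrt (1 / 2 * X i n t ^ 2)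
                ≤ (1 + (1 + 1 / 2 : ℝ) ^ ((10 : ℝ) * n)) * |X i n t| :=
                  mul_le_mul_of_nonneg_left hsq hpos
              _ ≤ 2 * max C 0 := by nlinarith
        init_E := fun i n => rfl
        init_X := hinit
        motion := by
          intro i n t ht
          rw [hFn i n t ht, sqrt_half_sq]
          have hs : (0 : ℝ) < Real.sqrt 2 := Real.sqrt_pos.2 (by norm_num)
          rw [show -((1 + 1 / 2 : ℝ) ^ ((2 : ℝ) * n)) * X i n t + quadTerm (1 / 2) α X i n t -
              quadTerm (1 / 2) α X i n t = -((1 + 1 / 2 : ℝ) ^ ((2 : ℝ) * n) * X i n t) by ring,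
            abs_neg, abs_mul, abs_of_nonneg (Real.rpow_nonneg h32 _)]
          rw [show Real.sqrt 2 * (1 + 1 / 2 : ℝ) ^ ((2 : ℝ) * n) * (|X i n t| / Real.sqrt 2) =
              (1 + 1 / 2 : ℝ) ^ ((2 : ℝ) * n) * |X i n t| by field_simp]
        energy := by
          intro i n t ht
          rw [hEn i n t ht]
          have : 0 ≤ (1 + 1 / 2 : ℝ) ^ ((2 : ℝ) * n) * (X i n t * X i n t) :=
            mul_nonneg (Real.rpow_nonneg h32 _) (mul_self_nonneg _)
          nlinarith
        defect_lower := fun i n t _ => le_rfl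
        defect_upper := fun i n t _ => by simp
        noLow_X := fun i n t hn _ => hlow i n t hn
        noLow_E := fun i n t hn _ => by simp [hlow i n t hn] }
  · -- blow-up branch: the variant would bound the maximal solution up to its blow-up time
    obtain ⟨C, hC⟩ := hCT lam hlam1 m (coeffOf α) (isSymm_coeffOf hαs) (isCyclic_coeffOf hαc)
      T hT X hcont hderiv (fun i n t hn => hlow i n t (lt_of_lt_of_le hn (le_max_right _ _)))
      hapr
    obtain ⟨i, n, t, ht, hlt⟩ := hunb C
    exact absurd (hC i n t ht) (not_le.mpr hlt)

end Summit.NavierStokesRegularity.NavierStokesRegularity.Theorems.CircuitTrace.Negative
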